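import Summits.HodgeConjecture.HodgeConjecture.Theorems.MarkmanPartnerTransportPicardThreeK3SquaresKugaSatakeSectorU2ab

/-!
# Route ELineTransport · aside `PicardSixteen` (stmt-HodgeConjecture-12551) — the Kuga–Satake sector by name

The aside `PicardSixteen` (HC⁴ of `S × S` for projective K3 surfaces with `ρ(S) = 16` and real
multiplication by `√m`) records as known "only the two 4-dimensional families with algebraic Kuga–Satake
correspondence (Varesco2025 Thm 0.2)". The MarkmanPartnerTransport prover lane (crux
`PicardThreeK3Squares`, file `Theorems/…KugaSatakeSectorU2ab`) has since landed the whole WITT-INDEX-TWO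
locus by name: HC for all powers and for `S ⊗ S` of every projective K3 surface with
`T(S)_ℚ ≅ U_ℚ² ⊕ ⟨a⟩ ⊕ ⟨b⟩` (`a, b < 0`; the tree's sign-free predicate `HasTranscendentalLatticeU2ab`),
modulo `Floccari2026_hodgeClasses_algebraic_powers_of_K3_of_transcendental_embedding` (Geom. Topol. 2026,
Thm. 5.11 (ii)) and `Huybrechts_K3_marking_exists` — with no family and no Kuga–Satake hypothesis, and for
every endomorphism type (`E = ℚ`, CM or RM). This file is the one-line pointer in the binder shape of
`PicardSixteen` (K3 clauses unfolded as there; the `√m`-structure `J`, the `ℚ + ℚJ` clause and the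
definiteness clause are not needed on this sector and are therefore not assumed):

* `picardSixteen_on_kugaSatakeSector` — HC⁴(`S ⊗ S`) for `S` as in `PicardSixteen` with
  `T(S)_ℚ ≅ U_ℚ² ⊕ ⟨a⟩ ⊕ ⟨b⟩`.

What remains of `PicardSixteen` is the Witt-index-ONE residue (`T(S)_ℚ` with no totally isotropic
plane; non-empty for RM lattices), see `KugaSatakeSector.exists_isotropic_pair_of_embedding` and
`Theorems/…Residue`. No definition, no sorry. Prover seat hodge-nonav-19652-p1 (gen 2),
`--supports stmt-HodgeConjecture-12551`.
-/

set_option linter.dupNamespace false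

noncomputable section

namespace Summit.HodgeConjecture.HodgeConjecture.Theorems.ELineTransport.PicardSixteenKugaSatake

open scoped Manifold
open CategoryTheory MonoidalCategory
open Literature.AlgebraicGeometry Literature.AlgebraicGeometry.Motives Literature.AlgebraicGeometry.HodgeTheory
open Literature.AlgebraicGeometry.Surfaces
open Literature.AlgebraicTopology.SingularHomology

/-- **`PicardSixteen` on the Kuga–Satake sector**: for a `ℂ`-scheme `S` with the K3 clauses of the
aside (smooth projective surface, `H¹(𝒪) = 0`, a nowhere-vanishing holomorphic `2`-form on a Hodge
model — i.e. `IsK3Surface S` unfolded) whose rational transcendental lattice is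
`U_ℚ² ⊕ ⟨a⟩ ⊕ ⟨b⟩` (`HasTranscendentalLatticeU2ab S a b`, `a, b < 0`; then `ρ(S) = 16`), the Hodge
conjecture holds for `S ⊗ S`, modulo Floccari's Thm. 5.11 (ii) and the existence of markings
(`KugaSatakeSector.hodgeConjectureFor_square_of_hasTranscendentalLatticeU2ab`).
[cite: Floccari2026, Thm. 5.11 (§5)] [cite: Varesco2025, Thm. 0.2 = Thm. 4.3 (§4)] -/
theorem picardSixteen_on_kugaSatakeSector
    (hF : Floccari2026_hodgeClasses_algebraic_powers_of_K3_of_transcendental_embedding)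
    (hmark : Huybrechts_K3_marking_exists) (S : SchemeOver ℂ)
    (hS : IsSmoothProjective 2 S ∧ Subsingleton (structureSheafCohomology S.left 1) ∧
      ∃ (A : HodgeModel 2 S) (η : Literature.Geometry.Kaehler.MForm 𝓘(ℝ, A.model) A.carrier ℂ 2),
        Literature.Geometry.Kaehler.IsHolomorphicInCharts η ∧ ∀ x, η x ≠ 0)
    {a b : ℤ} (ha : a < 0) (hb : b < 0) (hT : HasTranscendentalLatticeU2ab S a b) :
    HodgeConjectureFor 4 (S ⊗ S) :=
  MarkmanPartnerTransport.KugaSatakeSector.hodgeConjectureFor_square_of_hasTranscendentalLatticeU2ab hF hmark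
    (S := S) hS ha hb hT

end Summit.HodgeConjecture.HodgeConjecture.Theorems.ELineTransport.PicardSixteenKugaSatake

end
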